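import Literature.Topology.FourManifolds.SurgeredMappingTorus
import Literature.Topology.FourManifolds.GluingUniqueness
import HarnessLib

/-!
# Cutting a mapping torus along a fibre sliver: `T_{g ∘ φ} ∖ (S × {1}) ≅ T_φ ∖ (S × {1})`

First brick of the geometric core of R. Gompf, *More Cappell–Shaneson spheres are standard*,
Algebr. Geom. Topol. 10 (2010), Theorem 2.1 (`X^ε_{φ∘δᵏ} = X^ε_φ = X^ε_{δᵏ∘φ}` for a Dehn twist `δ`
along a torus in the fibre), towards the named facts
`Literature.Topology.FourManifolds.gompf2010_framedTwist` (**F**) and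
`Literature.Topology.FourManifolds.gompf2010_framedTwistZero` (**F₀**, which follows from F,
`GompfFramedTwistZero.lean`). The last paragraph of Gompf's proof reads: "It follows that `X^ε_φ`
is unchanged if we cut along this face and reglue by the given Dehn twist, or equivalently,
precede the surgery by cutting along an `M`-fiber and regluing by `δᵏ`. Thus, we have produced a
diffeomorphism from `X^ε_φ` to `X^ε_{φ∘δᵏ}`." This file supplies, in the tree's relational
language of open gluings (`Literature.Topology.FourManifolds.IsOpenGluingWith`, the smooth mapping
torus being an open gluing of the cylinders `M × (0, 1)` and `M × (1/2, 3/2)` along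
`Literature.Topology.FourManifolds.mappingTorusRel φ`, `(x, s) ∼ (φ x, s + 1)`), the identification
behind "cutting along an `M`-fiber and regluing":

* `Literature.Topology.FourManifolds.fibreSliver S = S × {1} ⊂ M × (1/2, 3/2)` — the part of the
  fibre `{t = 1}` (the only level of the second cylinder not glued to the first) where the
  regluing diffeomorphism `g` acts (`g = id` off `S`);
* `Literature.Topology.FourManifolds.sliverTwist g` — the two-branch map `(y, t) ↦ (g y, t)` for
  `t > 1`, `(y, t) ↦ (y, t)` for `t ≤ 1` of the second cylinder: smooth off the sliver
  (`contMDiffAt_sliverTwist`) and intertwining the gluing relations of `φ` and `g ∘ φ`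
  (`mappingTorusRel_sliverTwist_iff`);
* `Literature.Topology.FourManifolds.IsOpenGluingWith.exists_sliverDiffeomorph` — **if `T` is a
  mapping torus of `φ` and `T'` one of `g ∘ φ` (any open gluings with witnesses `jA, jB`, resp.
  `jA', jB'`), then `T ∖ jB (S × {1}) ≅ T' ∖ jB' (S × {1})` by a diffeomorphism `Θ` with
  `Θ ∘ jA = jA'` and `Θ ∘ jB = jB' ∘ sliverTwist g`**: away from the sliver the two gluings have
  the same pieces and the same relation, and the comparison map is smooth by descent of
  smoothness along the open embeddings `jA`, `jB` (`contMDiffAt_of_comp_isImmersionAt`,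
  Kosinski VI.1);
* `Literature.Topology.FourManifolds.IsOpenGluingWith.sliver_reglue` — consequently **`T'` is an
  open gluing of `T ∖ jB (S × {1})` and the second cylinder along the relation "reglue across the
  sliver by `g`"**: `u ∼ b :⟺ b ∉ S × {1} ∧ u = jB (sliverTwist g⁻¹ b)`, i.e. a point `(y, t)` of
  the cylinder just above the fibre `t = 1` is attached to `jB (g⁻¹ y, t)`, just below to
  `jB (y, t)`.

Everything here is generic in the fibre `M` (any charted space) and in the models; for Gompf's
theorem `M = T³`, `φ = torusDiffeomorph A`, `g = δ` a Dehn twist along the torus `{y₂ = const}`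
supported in a collar `S = {y₂ ∈ [a, b]}` (`CappellShanesonDeltaMove.lean`). The remaining (hard)
part of Theorem 2.1 is then a statement about ONE manifold: the surgered `X^σ_A` is *also* such a
regluing of itself minus the sliver, because the sliver twist extends to a diffeomorphism of the
complement of the sliver (the fishtail neighbourhood and Lemma 2.2 of loc. cit.); it is not
addressed in this file. No new named facts are introduced; every declaration is proved.

## References

* R. E. Gompf, *More Cappell–Shaneson spheres are standard*, Algebr. Geom. Topol. 10 (2010)
  1665–1681, doi:10.2140/agt.2010.10.1665 (arXiv:0908.1914): proof of Thm 2.1, last paragraph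
  ("cut along an `M`-fiber and reglue by `δᵏ`"). [GompfAGT2010]
* A. Kosinski, *Differential Manifolds* (1993), Ch. VI §1 (gluing; uniqueness of the glued
  structure). [Kosinski1993]
-/

open scoped Manifold ContDiff Topology
open Set Function

noncomputable section

namespace Literature.Topology.FourManifolds

/-! ### The fibre sliver and the sliver twist of the second cylinder -/

section Sliver

variable {M : Type*}

/-- **The fibre sliver `S × {1}`** of the second cylinder `M × (1/2, 3/2)` of a mapping torus:
the subset of the fibre `{t = 1}` — the level of the second cylinder which is not glued to the
first — lying over `S ⊆ M`. Cutting the mapping torus of `g ∘ φ` open along it, for `g`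
supported in `S`, undoes the twist `g` (Gompf 2010, proof of Thm 2.1: "cutting along an
`M`-fiber and regluing by `δᵏ`"). [cite: GompfAGT2010, Thm 2.1 (proof, last paragraph)] -/
def fibreSliver (S : Set M) : Set (M × ↥mappingTorusPieceTwo) :=
  {b | b.1 ∈ S ∧ (b.2 : ℝ) = 1}

/-- Membership in the fibre sliver. [folklore] -/
theorem mem_fibreSliver_iff {S : Set M} {b : M × ↥mappingTorusPieceTwo} :
    b ∈ fibreSliver S ↔ b.1 ∈ S ∧ (b.2 : ℝ) = 1 :=
  Iff.rfl

/-- The fibre sliver is the image of `S` under `y ↦ (y, 1)`. [folklore] -/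
theorem fibreSliver_eq_image (S : Set M) :
    fibreSliver S =
      (fun y : M ↦ (y, (⟨1, one_mem_pieceTwo⟩ : ↥mappingTorusPieceTwo))) '' S := by
  ext ⟨y, t⟩
  simp only [mem_fibreSliver_iff, mem_image, Prod.mk.injEq]
  constructor
  · rintro ⟨hy, ht⟩
    exact ⟨y, hy, rfl, Subtype.ext ht.symm⟩
  · rintro ⟨y', hy', rfl, ht⟩
    exact ⟨hy', by rw [← ht]⟩

variable (g : M → M)

/-- **The sliver twist** of the second cylinder `M × (1/2, 3/2)` by `g : M → M`: `(y, t) ↦ (g y, t)`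
above the fibre `t = 1` and the identity on and below it. For `g` supported in `S` it is smooth
off the fibre sliver `S × {1}` (`contMDiffAt_sliverTwist`), and it converts the gluing relation of
the mapping torus of `φ` into that of `g ∘ φ` (`mappingTorusRel_sliverTwist_iff`) — Gompf's
"reglue by `δᵏ`" across the cut fibre. [cite: GompfAGT2010, Thm 2.1 (proof, last paragraph)] -/
def sliverTwist (b : M × ↥mappingTorusPieceTwo) : M × ↥mappingTorusPieceTwo :=
  if 1 < (b.2 : ℝ) then (g b.1, b.2) else b

/-- Above the fibre `t = 1` the sliver twist is `(y, t) ↦ (g y, t)`. [folklore] -/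
theorem sliverTwist_of_one_lt {b : M × ↥mappingTorusPieceTwo} (h : 1 < (b.2 : ℝ)) :
    sliverTwist g b = (g b.1, b.2) :=
  if_pos h

/-- On and below the fibre `t = 1` the sliver twist is the identity. [folklore] -/
theorem sliverTwist_of_le_one {b : M × ↥mappingTorusPieceTwo} (h : (b.2 : ℝ) ≤ 1) :
    sliverTwist g b = b :=
  if_neg (not_lt.2 h)

/-- The sliver twist preserves the level `t`. [folklore] -/
@[simp] theorem sliverTwist_snd (b : M × ↥mappingTorusPieceTwo) : (sliverTwist g b).2 = b.2 := by
  unfold sliverTwist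
  split_ifs <;> rfl

/-- Sliver twists compose: `sliverTwist g ∘ sliverTwist g' = sliverTwist (g ∘ g')`. [folklore] -/
theorem sliverTwist_sliverTwist (g' : M → M) (b : M × ↥mappingTorusPieceTwo) :
    sliverTwist g (sliverTwist g' b) = sliverTwist (g ∘ g') b := by
  by_cases h : 1 < (b.2 : ℝ)
  · rw [sliverTwist_of_one_lt g' h, sliverTwist_of_one_lt (g ∘ g') h,
      sliverTwist_of_one_lt g
        (show (1 : ℝ) < (((g' b.1, b.2) : M × ↥mappingTorusPieceTwo).2 : ℝ) from h)]
    rfl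
  · rw [sliverTwist_of_le_one g' (not_lt.1 h), sliverTwist_of_le_one g (not_lt.1 h),
      sliverTwist_of_le_one (g ∘ g') (not_lt.1 h)]

/-- The sliver twist by the identity is the identity. [folklore] -/
theorem sliverTwist_id_apply (b : M × ↥mappingTorusPieceTwo) : sliverTwist (id : M → M) b = b := by
  by_cases h : 1 < (b.2 : ℝ)
  · rw [sliverTwist_of_one_lt id h]
    rfl
  · exact sliverTwist_of_le_one id (not_lt.1 h)

/-- A left inverse of `g` gives a left inverse of the sliver twist. [folklore] -/
theorem sliverTwist_sliverTwist_of_leftInverse {g g' : M → M} (h : LeftInverse g g')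
    (b : M × ↥mappingTorusPieceTwo) : sliverTwist g (sliverTwist g' b) = b := by
  rw [sliverTwist_sliverTwist, show g ∘ g' = id from funext h, sliverTwist_id_apply]

/-- The sliver twist maps the fibre sliver to itself and its complement to itself (the twist is
the identity on the fibre `t = 1`). [folklore] -/
theorem sliverTwist_mem_fibreSliver_iff {S : Set M} {b : M × ↥mappingTorusPieceTwo} :
    sliverTwist g b ∈ fibreSliver S ↔ b ∈ fibreSliver S := by
  by_cases h : 1 < (b.2 : ℝ)
  · rw [sliverTwist_of_one_lt g h]
    simp only [mem_fibreSliver_iff]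
    constructor
    · rintro ⟨-, h1⟩
      exact absurd h1 (ne_of_gt h)
    · rintro ⟨-, h1⟩
      exact absurd h1 (ne_of_gt h)
  · rw [sliverTwist_of_le_one g (not_lt.1 h)]

/-- For `g` supported in `S`, the sliver twist is the identity over `M ∖ S`. [folklore] -/
theorem sliverTwist_eq_self {S : Set M} (hg : ∀ y ∉ S, g y = y) {b : M × ↥mappingTorusPieceTwo}
    (hb : b.1 ∉ S) : sliverTwist g b = b := by
  by_cases h : 1 < (b.2 : ℝ)
  · rw [sliverTwist_of_one_lt g h, hg _ hb]
  · exact sliverTwist_of_le_one g (not_lt.1 h)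

/-- No point of the fibre `t = 1` of the second cylinder is glued to the first cylinder (the
relation `t = s` or `t = s + 1` with `s ∈ (0, 1)` forces `t ≠ 1`). [folklore] -/
theorem not_mappingTorusRel_of_coe_snd_eq_one (ψ : M → M) (a : M × ↥mappingTorusPieceOne)
    {b : M × ↥mappingTorusPieceTwo} (hb : (b.2 : ℝ) = 1) : ¬ mappingTorusRel ψ a b := by
  have hs := coe_prop_pieceOne a.2
  rintro (⟨h, -⟩ | ⟨h, -⟩) <;> linarith

/-- **The sliver twist intertwines the gluing relations of `φ` and `g ∘ φ`** (`g` injective):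
`(x, s) ∼_{g∘φ} sliverTwist g (y, t) ↔ (x, s) ∼_φ (y, t)`. On the overlap `t = s + 1 > 1` the
twist replaces `y` by `g y`, and `g y = g (φ x) ↔ y = φ x`; on the overlap `t = s < 1` both the
twist and the monodromy are absent. [cite: GompfAGT2010, Thm 2.1 (proof, last paragraph)] -/
theorem mappingTorusRel_sliverTwist_iff {φ g : M → M} (hg : Injective g)
    (a : M × ↥mappingTorusPieceOne) (b : M × ↥mappingTorusPieceTwo) :
    mappingTorusRel (g ∘ φ) a (sliverTwist g b) ↔ mappingTorusRel φ a b := by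
  obtain ⟨x, s⟩ := a
  obtain ⟨y, t⟩ := b
  have hs := coe_prop_pieceOne s
  by_cases h : 1 < (t : ℝ)
  · rw [sliverTwist_of_one_lt g (show 1 < (((y, t) : M × ↥mappingTorusPieceTwo).2 : ℝ) from h)]
    have hts : (t : ℝ) ≠ s := by
      intro e
      linarith [hs.2]
    simp only [mappingTorusRel, comp_apply, hts, false_and, false_or, hg.eq_iff]
  · rw [sliverTwist_of_le_one g (show (((y, t) : M × ↥mappingTorusPieceTwo).2 : ℝ) ≤ 1 from
      not_lt.1 h)]
    have hts : (t : ℝ) ≠ s + 1 := by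
      intro e
      linarith [hs.1, not_lt.1 h]
    simp only [mappingTorusRel, comp_apply, hts, false_and, or_false]

/-- **The complement of the (image of the) fibre sliver** `T ∖ jB (S × {1})`, an open subset of the
mapping torus, as an `Opens` (hence an open submanifold). [folklore] -/
def sliverCompl {T : Type*} [TopologicalSpace T] (jB : M × ↥mappingTorusPieceTwo → T) (S : Set M)
    (hc : IsClosed (jB '' fibreSliver S)) : TopologicalSpace.Opens T :=
  ⟨(jB '' fibreSliver S)ᶜ, hc.isOpen_compl⟩

/-- Membership in the complement of the sliver. [folklore] -/
@[simp] theorem mem_sliverCompl_iff {T : Type*} [TopologicalSpace T]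
    {jB : M × ↥mappingTorusPieceTwo → T} {S : Set M} {hc : IsClosed (jB '' fibreSliver S)} {p : T} :
    p ∈ sliverCompl jB S hc ↔ p ∉ jB '' fibreSliver S :=
  Iff.rfl

variable [TopologicalSpace M]

/-- The fibre sliver over a compact set is compact. [folklore] -/
theorem isCompact_fibreSliver {S : Set M} (hS : IsCompact S) : IsCompact (fibreSliver S) := by
  rw [fibreSliver_eq_image]
  exact hS.image (continuous_id.prodMk continuous_const)

/-- The fibre sliver over a closed set is closed. [folklore] -/
theorem isClosed_fibreSliver {S : Set M} (hS : IsClosed S) : IsClosed (fibreSliver S) :=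
  (hS.preimage continuous_fst).inter
    (isClosed_singleton.preimage (continuous_subtype_val.comp continuous_snd))

/-- The image of the fibre sliver over a compact set under a continuous map into a Hausdorff
space is closed (so that its complement is an open submanifold). [folklore] -/
theorem isClosed_image_fibreSliver {T : Type*} [TopologicalSpace T] [T2Space T]
    {j : M × ↥mappingTorusPieceTwo → T} (hj : Continuous j) {S : Set M} (hS : IsCompact S) :
    IsClosed (j '' fibreSliver S) :=
  ((isCompact_fibreSliver hS).image hj).isClosed

variable {E H : Type*} [NormedAddCommGroup E] [NormedSpace ℝ E] [TopologicalSpace H]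
  {I : ModelWithCorners ℝ E H} [ChartedSpace H M]

/-- **The sliver twist is smooth off the fibre sliver** when `g` is smooth and supported in the
closed set `S`: above the fibre it is `g × id`, below it the identity, and near a point `(y, 1)`
with `y ∉ S` both branches are the identity on the neighbourhood `(M ∖ S) × (1/2, 3/2)`. [folklore] -/
theorem contMDiffAt_sliverTwist {g : M → M} (hg : ContMDiff I I ∞ g) {S : Set M}
    (hS : IsClosed S) (hgS : ∀ y ∉ S, g y = y) {b : M × ↥mappingTorusPieceTwo}
    (hb : b ∉ fibreSliver S) :
    ContMDiffAt (I.prod 𝓘(ℝ, ℝ)) (I.prod 𝓘(ℝ, ℝ)) ∞ (sliverTwist g) b := by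
  have hcont : Continuous fun b : M × ↥mappingTorusPieceTwo ↦ (b.2 : ℝ) :=
    continuous_subtype_val.comp continuous_snd
  rcases lt_trichotomy 1 (b.2 : ℝ) with h | h | h
  · have hev : sliverTwist g =ᶠ[𝓝 b] fun b ↦ (g b.1, b.2) :=
      Filter.eventually_of_mem ((isOpen_lt continuous_const hcont).mem_nhds h)
        fun b' hb' ↦ sliverTwist_of_one_lt g hb'
    exact (((hg.comp contMDiff_fst).prodMk contMDiff_snd).contMDiffAt).congr_of_eventuallyEq hev
  · have hy : b.1 ∉ S := fun hy ↦ hb ⟨hy, h.symm⟩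
    have ho : IsOpen {b' : M × ↥mappingTorusPieceTwo | b'.1 ∈ Sᶜ} :=
      hS.isOpen_compl.preimage continuous_fst
    have hev : sliverTwist g =ᶠ[𝓝 b] id :=
      Filter.eventually_of_mem (ho.mem_nhds hy) fun b' hb' ↦ sliverTwist_eq_self g hgS hb'
    exact contMDiffAt_id.congr_of_eventuallyEq hev
  · have hev : sliverTwist g =ᶠ[𝓝 b] id :=
      Filter.eventually_of_mem ((isOpen_lt hcont continuous_const).mem_nhds h)
        fun b' hb' ↦ sliverTwist_of_le_one g (le_of_lt hb')
    exact contMDiffAt_id.congr_of_eventuallyEq hev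

end Sliver

/-! ### Comparing the mapping tori of `φ` and `g ∘ φ` off the sliver -/

section Compare

variable {E H : Type*} [NormedAddCommGroup E] [NormedSpace ℝ E] [TopologicalSpace H]
  {I : ModelWithCorners ℝ E H} {M : Type*} [TopologicalSpace M] [ChartedSpace H M]
  {EP HP : Type*} [NormedAddCommGroup EP] [NormedSpace ℝ EP] [TopologicalSpace HP]
  {IP : ModelWithCorners ℝ EP HP}
  {T T' : Type*} [TopologicalSpace T] [ChartedSpace HP T] [TopologicalSpace T'] [ChartedSpace HP T']
  {φ : M → M} (g : M ≃ₘ⟮I, I⟯ M)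
  {jA : M × ↥mappingTorusPieceOne → T} {jB : M × ↥mappingTorusPieceTwo → T}
  {jA' : M × ↥mappingTorusPieceOne → T'} {jB' : M × ↥mappingTorusPieceTwo → T'}

/-- **The comparison map `T_φ → T_{g∘φ}`, set-theoretically**: `jA a ↦ jA' a`,
`jB b ↦ jB' (sliverTwist g b)` is well defined, because the sliver twist converts the relation of
`φ` into that of `g ∘ φ` (`mappingTorusRel_sliverTwist_iff`; the junk values of the twist on the
fibre `t = 1` never enter, that fibre not being glued). [cite: GompfAGT2010, Thm 2.1 (proof, last paragraph)] -/
theorem IsOpenGluingWith.exists_sliverMap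
    (h : IsOpenGluingWith (I.prod 𝓘(ℝ, ℝ)) (I.prod 𝓘(ℝ, ℝ)) IP (mappingTorusRel φ) jA jB)
    (h' : IsOpenGluingWith (I.prod 𝓘(ℝ, ℝ)) (I.prod 𝓘(ℝ, ℝ)) IP (mappingTorusRel (g ∘ φ)) jA' jB') :
    ∃ G : T → T', (∀ a, G (jA a) = jA' a) ∧ ∀ b, G (jB b) = jB' (sliverTwist g b) := by
  obtain ⟨hA, -, hB, -, hU, hR⟩ := h
  obtain ⟨-, -, -, -, -, hR'⟩ := h'
  obtain ⟨G, hGA, hGB⟩ := IsOpenGluing.exists_map_apply_eq (jA' := jA')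
    (jB' := jB' ∘ sliverTwist g) hU hA.isEmbedding.injective hB.isEmbedding.injective
    fun a b hab ↦ by
      rw [comp_apply, hR' a, mappingTorusRel_sliverTwist_iff (g := (g : M → M)) g.injective]
      exact (hR a b).1 hab
  exact ⟨G, hGA, fun b ↦ hGB b⟩

/-- **The comparison map preserves the complements of the slivers**: `G (T ∖ jB (S × {1})) ⊆
T' ∖ jB' (S × {1})` — a point `jA a` is never glued to the fibre `t = 1`, and the sliver twist
preserves the sliver. [folklore] -/
theorem IsOpenGluingWith.sliverMap_not_mem
    (h : IsOpenGluingWith (I.prod 𝓘(ℝ, ℝ)) (I.prod 𝓘(ℝ, ℝ)) IP (mappingTorusRel φ) jA jB)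
    (h' : IsOpenGluingWith (I.prod 𝓘(ℝ, ℝ)) (I.prod 𝓘(ℝ, ℝ)) IP (mappingTorusRel (g ∘ φ)) jA' jB')
    {S : Set M} {G : T → T'} (hGA : ∀ a, G (jA a) = jA' a)
    (hGB : ∀ b, G (jB b) = jB' (sliverTwist g b)) {p : T} (hp : p ∉ jB '' fibreSliver S) :
    G p ∉ jB' '' fibreSliver S := by
  obtain ⟨-, -, -, -, hU, -⟩ := h
  obtain ⟨-, -, hB', -, -, hR'⟩ := h'
  rintro ⟨σ, hσ, hσp⟩
  rcases eq_univ_iff_forall.1 hU p with ⟨a, rfl⟩ | ⟨b, rfl⟩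
  · rw [hGA] at hσp
    exact not_mappingTorusRel_of_coe_snd_eq_one (g ∘ φ) a hσ.2 ((hR' a σ).1 hσp.symm)
  · rw [hGB] at hσp
    have hσb : σ = sliverTwist g b := hB'.isEmbedding.injective hσp
    refine hp ⟨b, ?_, rfl⟩
    rw [← sliverTwist_mem_fibreSliver_iff g, ← hσb]
    exact hσ

/-- **The comparison map is smooth off the sliver** (descent of smoothness along the open
embeddings `jA`, `jB`: `G ∘ jA = jA'` is smooth, and `G ∘ jB = jB' ∘ sliverTwist g` is smooth off
the sliver for `g` supported in the closed set `S`; Kosinski VI.1). [cite: Kosinski1993, Ch. VI §1, proof of Thm (1.1)] -/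
theorem IsOpenGluingWith.contMDiffAt_sliverMap [IsManifold IP ∞ T']
    (h : IsOpenGluingWith (I.prod 𝓘(ℝ, ℝ)) (I.prod 𝓘(ℝ, ℝ)) IP (mappingTorusRel φ) jA jB)
    (h' : IsOpenGluingWith (I.prod 𝓘(ℝ, ℝ)) (I.prod 𝓘(ℝ, ℝ)) IP (mappingTorusRel (g ∘ φ)) jA' jB')
    {S : Set M} (hS : IsClosed S) (hgS : ∀ y ∉ S, g y = y)
    {G : T → T'} (hGA : ∀ a, G (jA a) = jA' a) (hGB : ∀ b, G (jB b) = jB' (sliverTwist g b))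
    {p : T} (hp : p ∉ jB '' fibreSliver S) : ContMDiffAt IP IP ∞ G p := by
  obtain ⟨hA, hAo, hB, hBo, hU, -⟩ := h
  obtain ⟨hA', -, hB', -, -, -⟩ := h'
  rcases eq_univ_iff_forall.1 hU p with ⟨a, rfl⟩ | ⟨b, rfl⟩
  · exact contMDiffAt_of_comp_isImmersionAt (hA.isImmersion.isImmersionAt a)
      (Topology.IsOpenEmbedding.isOpenMap ⟨hA.isEmbedding, hAo⟩) (hA'.contMDiff a) hGA
  · have hb : b ∉ fibreSliver S := fun hb ↦ hp ⟨b, hb, rfl⟩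
    exact contMDiffAt_of_comp_isImmersionAt (hB.isImmersion.isImmersionAt b)
      (Topology.IsOpenEmbedding.isOpenMap ⟨hB.isEmbedding, hBo⟩)
      ((hB'.contMDiff _).comp b (contMDiffAt_sliverTwist g.contMDiff hS hgS hb)) hGB

/-- For `g` supported in `S`, so is `g⁻¹`. [folklore] -/
theorem symm_apply_eq_self_of_not_mem {S : Set M} (hgS : ∀ y ∉ S, g y = y) (y : M) (hy : y ∉ S) :
    g.symm y = y := by
  conv_lhs => rw [← hgS y hy]
  exact g.symm_apply_apply y

/-- A gluing along `mappingTorusRel φ` is a gluing along `mappingTorusRel (g⁻¹ ∘ (g ∘ φ))`. [folklore] -/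
theorem IsOpenGluingWith.of_symm_comp_comp
    (h : IsOpenGluingWith (I.prod 𝓘(ℝ, ℝ)) (I.prod 𝓘(ℝ, ℝ)) IP (mappingTorusRel φ) jA jB) :
    IsOpenGluingWith (I.prod 𝓘(ℝ, ℝ)) (I.prod 𝓘(ℝ, ℝ)) IP (mappingTorusRel (g.symm ∘ (g ∘ φ)))
      jA jB := by
  rwa [show (g.symm : M → M) ∘ ((g : M → M) ∘ φ) = φ from
    funext fun x ↦ g.symm_apply_apply (φ x)]

variable [IsManifold IP ∞ T] [IsManifold IP ∞ T']

/-- **Cutting along a fibre sliver undoes the twist: `T_φ ∖ jB (S × {1}) ≅ T_{g∘φ} ∖ jB' (S × {1})`.**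
For a diffeomorphism `g` of the fibre supported in a closed set `S` (`g = id` off `S`), an open
gluing `T` of the cylinders along `mappingTorusRel φ` and an open gluing `T'` along
`mappingTorusRel (g ∘ φ)` become diffeomorphic after deleting the slivers `jB (S × {1})`,
`jB' (S × {1})` (closed, e.g. for compact `S`, `isClosed_image_fibreSliver`), by a diffeomorphism
`Θ` with `Θ (jA a) = jA' a` and `Θ (jB b) = jB' (sliverTwist g b)`: both sides are covered by the
same pieces glued along the same relation once the twist is pushed into the parametrisation of
the second cylinder above the cut fibre. This is the identification behind Gompf's "cutting
along an `M`-fiber and regluing by `δᵏ`" (proof of Thm 2.1, last paragraph). [cite: GompfAGT2010, Thm 2.1 (proof, last paragraph)] -/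
theorem IsOpenGluingWith.exists_sliverDiffeomorph
    (h : IsOpenGluingWith (I.prod 𝓘(ℝ, ℝ)) (I.prod 𝓘(ℝ, ℝ)) IP (mappingTorusRel φ) jA jB)
    (h' : IsOpenGluingWith (I.prod 𝓘(ℝ, ℝ)) (I.prod 𝓘(ℝ, ℝ)) IP (mappingTorusRel (g ∘ φ)) jA' jB')
    {S : Set M} (hS : IsClosed S) (hgS : ∀ y ∉ S, g y = y)
    (hc : IsClosed (jB '' fibreSliver S)) (hc' : IsClosed (jB' '' fibreSliver S)) :
    ∃ Θ : ↥(sliverCompl jB S hc) ≃ₘ⟮IP, IP⟯ ↥(sliverCompl jB' S hc'),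
      (∀ (u : ↥(sliverCompl jB S hc)) (a : M × ↥mappingTorusPieceOne),
          (u : T) = jA a → (Θ u : T') = jA' a) ∧
        ∀ (u : ↥(sliverCompl jB S hc)) (b : M × ↥mappingTorusPieceTwo),
          (u : T) = jB b → (Θ u : T') = jB' (sliverTwist g b) := by
  have hgS' : ∀ y ∉ S, g.symm y = y := symm_apply_eq_self_of_not_mem g hgS
  have h₁ := h.of_symm_comp_comp g
  obtain ⟨G, hGA, hGB⟩ := h.exists_sliverMap g h'
  obtain ⟨G', hGA', hGB'⟩ := h'.exists_sliverMap g.symm h₁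
  have hmem : ∀ p, p ∉ jB '' fibreSliver S → G p ∉ jB' '' fibreSliver S :=
    fun p hp ↦ h.sliverMap_not_mem g h' hGA hGB hp
  have hmem' : ∀ p, p ∉ jB' '' fibreSliver S → G' p ∉ jB '' fibreSliver S :=
    fun p hp ↦ h'.sliverMap_not_mem g.symm h₁ hGA' hGB' hp
  have hsm : ∀ p, p ∉ jB '' fibreSliver S → ContMDiffAt IP IP ∞ G p :=
    fun p hp ↦ h.contMDiffAt_sliverMap g h' hS hgS hGA hGB hp
  have hsm' : ∀ p, p ∉ jB' '' fibreSliver S → ContMDiffAt IP IP ∞ G' p :=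
    fun p hp ↦ h'.contMDiffAt_sliverMap g.symm h₁ hS hgS' hGA' hGB' hp
  obtain ⟨-, -, -, -, hU, -⟩ := h
  obtain ⟨-, -, -, -, hU', -⟩ := h'
  have hleft : ∀ p, G' (G p) = p := fun p ↦ by
    rcases eq_univ_iff_forall.1 hU p with ⟨a, rfl⟩ | ⟨b, rfl⟩
    · rw [hGA, hGA']
    · rw [hGB, hGB', sliverTwist_sliverTwist_of_leftInverse g.symm_apply_apply]
  have hright : ∀ p, G (G' p) = p := fun p ↦ by
    rcases eq_univ_iff_forall.1 hU' p with ⟨a, rfl⟩ | ⟨b, rfl⟩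
    · rw [hGA', hGA]
    · rw [hGB', hGB, sliverTwist_sliverTwist_of_leftInverse g.apply_symm_apply]
  refine ⟨{ toFun := fun u ↦ ⟨G u, hmem u u.2⟩
            invFun := fun u' ↦ ⟨G' u', hmem' u' u'.2⟩
            left_inv := fun u ↦ Subtype.ext (hleft u)
            right_inv := fun u' ↦ Subtype.ext (hright u')
            contMDiff_toFun := ?_
            contMDiff_invFun := ?_ }, fun u a hu ↦ ?_, fun u b hu ↦ ?_⟩
  · rw [← ContMDiff.subtypeVal_comp_iff]
    intro u
    show ContMDiffAt IP IP ∞ (fun u : ↥(sliverCompl jB S hc) ↦ G u) u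
    rw [contMDiffAt_subtype_iff]
    exact hsm u u.2
  · rw [← ContMDiff.subtypeVal_comp_iff]
    intro u'
    show ContMDiffAt IP IP ∞ (fun u' : ↥(sliverCompl jB' S hc') ↦ G' u') u'
    rw [contMDiffAt_subtype_iff]
    exact hsm' u' u'.2
  · show G u = jA' a
    rw [hu, hGA]
  · show G u = jB' (sliverTwist g b)
    rw [hu, hGB]

/-- **Regluing across the sliver.** In the situation of `exists_sliverDiffeomorph`, for any
diffeomorphism `Θ : T ∖ jB (S × {1}) ≅ T' ∖ jB' (S × {1})` with `Θ ∘ jA = jA'` and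
`Θ ∘ jB = jB' ∘ sliverTwist g`, the mapping torus `T'` of `g ∘ φ` is an open gluing of the cut
mapping torus `T ∖ jB (S × {1})` of `φ` and the second cylinder `M × (1/2, 3/2)`, glued by `Θ`
and `jB'` along the relation "reglue by `g` across the fibre":
`u ∼ (y, t) :⟺ (y, t) ∉ S × {1} ∧ u = jB (sliverTwist g⁻¹ (y, t))` — above the fibre `t = 1` the
point `(y, t)` of the cylinder is attached to `jB (g⁻¹ y, t)`, on and below it to `jB (y, t)`.
This is the "cut along an `M`-fiber and reglue by `δᵏ`" presentation of `X_{φ∘δᵏ}` in Gompf's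
proof of Theorem 2.1 (before the surgery). [cite: GompfAGT2010, Thm 2.1 (proof, last paragraph)] -/
theorem IsOpenGluingWith.sliver_reglue
    (h : IsOpenGluingWith (I.prod 𝓘(ℝ, ℝ)) (I.prod 𝓘(ℝ, ℝ)) IP (mappingTorusRel φ) jA jB)
    (h' : IsOpenGluingWith (I.prod 𝓘(ℝ, ℝ)) (I.prod 𝓘(ℝ, ℝ)) IP (mappingTorusRel (g ∘ φ)) jA' jB')
    {S : Set M} (hc : IsClosed (jB '' fibreSliver S)) (hc' : IsClosed (jB' '' fibreSliver S))
    (Θ : ↥(sliverCompl jB S hc) ≃ₘ⟮IP, IP⟯ ↥(sliverCompl jB' S hc'))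
    (hΘA : ∀ (u : ↥(sliverCompl jB S hc)) (a : M × ↥mappingTorusPieceOne),
      (u : T) = jA a → (Θ u : T') = jA' a)
    (hΘB : ∀ (u : ↥(sliverCompl jB S hc)) (b : M × ↥mappingTorusPieceTwo),
      (u : T) = jB b → (Θ u : T') = jB' (sliverTwist g b)) :
    IsOpenGluingWith IP (I.prod 𝓘(ℝ, ℝ)) IP
      (fun (u : ↥(sliverCompl jB S hc)) (b : M × ↥mappingTorusPieceTwo) ↦
        b ∉ fibreSliver S ∧ (u : T) = jB (sliverTwist g.symm b))
      (fun u ↦ (Θ u : T')) jB' := by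
  obtain ⟨-, -, -, -, hU, hR⟩ := h
  obtain ⟨-, -, hB', hBo', -, hR'⟩ := h'
  refine ⟨(Manifold.IsSmoothEmbedding.of_opens (sliverCompl jB' S hc')).comp_diffeomorph Θ, ?_,
    hB', hBo', ?_, fun u b ↦ ?_⟩
  · -- the range of `u ↦ Θ u` is the open set `T' ∖ jB' (S × {1})`
    have hr : range (fun u ↦ (Θ u : T')) = (sliverCompl jB' S hc' : Set T') := by
      ext p
      constructor
      · rintro ⟨u, rfl⟩
        exact (Θ u).2
      · intro hp
        exact ⟨Θ.symm ⟨p, hp⟩, by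
          show ((Θ (Θ.symm ⟨p, hp⟩) : ↥(sliverCompl jB' S hc')) : T') = p
          rw [Diffeomorph.apply_symm_apply]⟩
    rw [hr]
    exact (sliverCompl jB' S hc').2
  · refine eq_univ_iff_forall.2 fun p ↦ ?_
    by_cases hp : p ∈ jB' '' fibreSliver S
    · obtain ⟨b, -, rfl⟩ := hp
      exact Or.inr ⟨b, rfl⟩
    · exact Or.inl ⟨Θ.symm ⟨p, hp⟩, by
        show ((Θ (Θ.symm ⟨p, hp⟩) : ↥(sliverCompl jB' S hc')) : T') = p
        rw [Diffeomorph.apply_symm_apply]⟩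
  · have hcomp : (g.symm : M → M) ∘ ((g : M → M) ∘ φ) = φ :=
      funext fun x ↦ g.symm_apply_apply (φ x)
    constructor
    · intro hub
      change (Θ u : T') = jB' b at hub
      rcases eq_univ_iff_forall.1 hU (u : T) with ⟨a, ha⟩ | ⟨b₀, hb₀⟩
      · -- `u = jA a`: then `jA' a = jB' b`, so `(a, b)` are related for `g ∘ φ`
        rw [hΘA u a ha.symm] at hub
        have hrel : mappingTorusRel ((g : M → M) ∘ φ) a b := (hR' a b).1 hub
        have h2 : mappingTorusRel ((g.symm : M → M) ∘ ((g : M → M) ∘ φ)) a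
            (sliverTwist g.symm b) :=
          (mappingTorusRel_sliverTwist_iff (g := (g.symm : M → M)) g.symm.injective a b).2 hrel
        rw [hcomp] at h2
        refine ⟨fun hb ↦ not_mappingTorusRel_of_coe_snd_eq_one ((g : M → M) ∘ φ) a hb.2 hrel, ?_⟩
        rw [← ha]
        exact (hR a _).2 h2
      · -- `u = jB b₀` with `b₀` off the sliver: then `b = sliverTwist g b₀`
        have hb₀s : b₀ ∉ fibreSliver S := fun hmem ↦ u.2 ⟨b₀, hmem, hb₀⟩
        rw [hΘB u b₀ hb₀.symm] at hub
        have hb : sliverTwist g b₀ = b := hB'.isEmbedding.injective hub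
        refine ⟨?_, ?_⟩
        · rw [← hb, sliverTwist_mem_fibreSliver_iff]
          exact hb₀s
        · rw [← hb, sliverTwist_sliverTwist_of_leftInverse g.symm_apply_apply]
          exact hb₀.symm
    · rintro ⟨-, hu⟩
      change (Θ u : T') = jB' b
      rw [hΘB u _ hu, sliverTwist_sliverTwist_of_leftInverse g.apply_symm_apply]

end Compare

end Literature.Topology.FourManifolds
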